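import Summits.Langlands.Langlands.Theorems.EisensteinGelfandKirillovCrystallineProModularClassicalDefs
import Literature.NumberTheory.Automorphic.GL2TowerTorsionRelationsClassical
import Literature.NumberTheory.Automorphic.ResGLnCohomologyRationalRelations

/-!
# Stub S2' `stub_tameLevelStripping` (line `torsion-weight-exchange`, crux stmt-Langlands-18274):
# the corrected signature (level `𝔫p^r`, `r` growing with the precision) PROVED modulo two named
# Literature facts — Scholze's torsion-to-classical comparison for the `GL₂/F` tower and the
# rationality of Hecke relations

Theorems file for the registered stub `stub_tameLevelStripping` (S2'; lead rev 5 — the two named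
facts below are its leading hypotheses; worker proof of wave 2, prover-line-stmt-Langlands-18274-a2-0,
2026-08-17) of the checked skeleton
`Cruxes/CrystallineProModularClassical/Lines/torsion_weight_exchange.lean`, in the skeleton's
namespace `Summit.Langlands.Langlands.Cruxes.CrystallineProModularClassical.TorsionWeightExchange`,
over the landed line vocabulary `EisensteinGelfandKirillovCrystallineProModularClassicalDefs`
(`FactorsThroughFiniteLevelModP`, `IsIntegralPoly`, `FactorsThroughClassicalModP`).

**The two published inputs (named facts, landed by this worker; nothing is vendored here).**
* `Literature.NumberTheory.Automorphic.BigHeckeGLn.Scholze2015_gl2TowerHeckeRelations_classical`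
  (`Literature/NumberTheory/Automorphic/GL2TowerTorsionRelationsClassical.lean`, p165094 ACCEPTED): for `F`
  totally real, `p ≥ 5`, `p ∤ disc F`, `𝒰 : TameLevel 2 F p` there are `𝔫 ≠ 0` and `N ≥ 1` such that
  for every finite set `J` of tower indices there are `e` and a finite PARALLEL-weight family of
  receptacles `H^{q_k}(S_{K_f(𝔫p^e)}, Ẽ_{λ_k}(ℚ̄_p))` whose INTEGER Hecke relations `Q` (letters at
  `v ∉ 𝒰.bad`, `v ∤ 𝔫p^e`) satisfy `Q(T^tower)^N = 0` on `H^i(X_{U_r}, ℤ/p^s)`, `(r,s,i) ∈ J`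
  (Scholze 2015 Thm. IV.3.1 + Cor. IV.2.2 / V.2.6 / §V.4, Newton–Thorne 2016 §3–4, Harder 1987,
  Caraiani–Tamiozzo 2023 §2, Emerton–Reduzzi–Xiao 2017 §2; consequence form, see its docstring).
* `Literature.NumberTheory.Automorphic.ResGLnCohomology.heckeRelations_definedOverInt`
  (`Literature/NumberTheory/Automorphic/ResGLnCohomologyRationalRelations.lean`, p164426 ACCEPTED):
  on a finite parallel-weight family, every `ℚ̄_p`-polynomial relation with INTEGRAL coefficients
  (`IsIntegralPoly`) is `Σ c_i • Q_i`, `‖c_i‖ ≤ 1`, `Q_i` integer relations (Grobner–Raghuram 2014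
  Lemma 37–38 after Clozel; flatness of `𝒪_{ℚ̄_p}` over `ℤ`).  This is the bridge between the
  line's `ℚ̄_p`-integral relation currency and the INTEGER Hecke algebra of Scholze's theorem;
  without it an integral `ℚ̄_p`-relation such as `X_v − a_v` (one eigenvalue of a non-rational
  eigenform) is not an element of `𝕋(𝒰)` and the finite-level hypothesis cannot be applied.

**What is proved here (no `sorry`, standard axioms).**
* `coe_freeRingLift`, `ringHom_freeRingLift`, `freeAlgebraLift_freeRingLift`: bookkeeping for
  integer non-commutative polynomials (`FreeRing`) evaluated in `𝕋(𝒰) ⊆ ∏ End`, pushed through a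
  ring homomorphism, and base-changed to `ℚ̄_p⟨X⟩`.
* `stub_tameLevelStripping_of_scholze2015`: the registered signature VERBATIM with the two facts as
  leading hypotheses.  Proof = the nilpotence/precision bookkeeping of the brief: given `s`, take
  `σ = N·s` and the finite index set `J = J(σ)` of `FactorsThroughFiniteLevelModP 𝒰 x σ`; the
  first fact gives `e` and the family; for an integral relation `P` on it the second fact gives
  `P = Σ c_i Q_i`; each `t_i = Q_i(heckeT) ∈ 𝕋(𝒰)` has `(t_i^N)_j = Q_i(heckeOperator)^N _j = 0` for
  `j ∈ J` (`TameLevel.coe_heckeT`), so `‖x t_i‖^N = ‖x(t_i^N)‖ ≤ p^{-Ns}`, `‖x t_i‖ ≤ p^{-s}`, and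
  `‖P(x)‖ = ‖Σ c_i x(t_i)‖ ≤ p^{-s}` ultrametrically.  Uniformity of `N` in `J` is exactly what makes
  the order "choose `N`, then `J = J(Ns)`, then the family" possible.
* `stub_tameLevelStripping`: the registered signature (rev 5: `<fact A> → <fact B> → <S2'>`), one line
  from `stub_tameLevelStripping_of_scholze2015`.

**Audit of the corrected signature (task 4).**  No new defect found.  (i) `∃ 𝔫 ∀ s` with ONE tame
level is right: the tame level of Scholze's classical forms is the fixed `K^p` (here `𝔫` =
prime-to-`p` conductor of `U` times one auxiliary split prime `ℓ ≢ ±1 mod p`, depending on `𝒰`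
only, not on `x`).  (ii) The guard `v ∉ 𝒰.bad ∧ v ∤ 𝔫p^r` is consistent with `𝒰.bad ⊇ {v ∣ p}` and
excludes the auxiliary `ℓ ∣ 𝔫`, as it must.  (iii) Non-liftable torsion eigensystems and
non-semisimple torsion Hecke modules (the `H¹ … H^{3g−1}` sectors) are absorbed by the nilpotence
exponent, which only costs precision (`σ = Ns`); the predecessor's `H⁰`/character obstruction is
absent at level `𝔫p^{r(s)}` (the boundary/`H⁰` sector is controlled EXACTLY by the group ring of
the ray class group of level `𝔫p^e`, `e ≥ s`).  (iv) A genuine subtlety surfaced and is now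
explicit: the line's relation currency is over `ℚ̄_p` while every torsion-to-classical theorem is
about the INTEGER Hecke algebra; the bridge is the rationality of the (parallel-weight) family —
the second fact —, true and standard but not provable in the tree today (no `ℚ`-form of parallel
`E_λ`, no universal coefficients for `groupCohomology`, no Galois descent).  (v) `x` need not be
continuous: only `∀ s, FactorsThroughFiniteLevelModP` and integrality are used, as registered.
-/

set_option linter.dupNamespace false
set_option autoImplicit false

noncomputable section

namespace Summit.Langlands.Langlands.Cruxes.CrystallineProModularClassical.TorsionWeightExchange

open Summit.Langlands.Langlands.Theses.EisensteinGelfandKirillov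
open Literature.NumberTheory.Automorphic Literature.NumberTheory.GaloisRepresentations
open Literature.NumberTheory.Automorphic.BigHeckeGLn
open NumberField IsDedekindDomain Filter
open scoped Classical

variable {F : Type} [Field F] [NumberField F] {p : ℕ} [Fact p.Prime]

/-! ## 1. Integer non-commutative polynomials in Hecke operators (bookkeeping) -/

/-- Evaluating an integer non-commutative polynomial at elements of `𝕋(𝒰)` and then passing to the
product ring `∏ End(H^i(X_{U_r}, ℤ/p^s))` is evaluating it in the product ring (`FreeRing.hom_ext`).
[folklore] -/
theorem coe_freeRingLift (𝒰 : TameLevel 2 F p) {r : ℕ}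
    (f : Fin r → CompletedCohomologyHeckeAlgebraGLn 𝒰) (Q : FreeRing (Fin r)) :
    ((FreeRing.lift f Q : CompletedCohomologyHeckeAlgebraGLn 𝒰) : 𝒰.bigEnd) =
      FreeRing.lift (fun j => (f j : 𝒰.bigEnd)) Q := by
  have h : 𝒰.bigHeckeSubring.subtype.comp (FreeRing.lift f) =
      FreeRing.lift (fun j => (f j : 𝒰.bigEnd)) :=
    FreeRing.hom_ext fun j => by simp [FreeRing.lift_of]
  exact RingHom.congr_fun h Q

/-- A ring homomorphism out of `𝕋(𝒰)` takes an integer non-commutative polynomial in Hecke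
operators to the same polynomial in their images (`FreeRing.hom_ext`). [folklore] -/
theorem ringHom_freeRingLift {R : Type*} [Ring R] (𝒰 : TameLevel 2 F p)
    (x : CompletedCohomologyHeckeAlgebraGLn 𝒰 →+* R) {r : ℕ}
    (f : Fin r → CompletedCohomologyHeckeAlgebraGLn 𝒰) (Q : FreeRing (Fin r)) :
    x (FreeRing.lift f Q) = FreeRing.lift (fun j => x (f j)) Q := by
  have h : x.comp (FreeRing.lift f) = FreeRing.lift (fun j => x (f j)) :=
    FreeRing.hom_ext fun j => by simp [FreeRing.lift_of]
  exact RingHom.congr_fun h Q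

/-- Base change of an integer non-commutative polynomial to `ℚ̄_p⟨X⟩`
(`FreeRing.lift (FreeAlgebra.ι ℚ̄_p)`) commutes with evaluation in a `ℚ̄_p`-algebra. [folklore] -/
theorem freeAlgebraLift_freeRingLift {A : Type*} [Ring A] [Algebra (PadicAlgCl p) A] {r : ℕ}
    (f : Fin r → A) (Q : FreeRing (Fin r)) :
    FreeAlgebra.lift (PadicAlgCl p) f (FreeRing.lift (FreeAlgebra.ι (PadicAlgCl p)) Q) =
      FreeRing.lift f Q := by
  have h : (FreeAlgebra.lift (PadicAlgCl p) f).toRingHom.comp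
      (FreeRing.lift (FreeAlgebra.ι (PadicAlgCl p))) = FreeRing.lift f :=
    FreeRing.hom_ext fun j => by simp [FreeRing.lift_of]
  exact RingHom.congr_fun h Q

/-! ## 2. The stub modulo the two named facts -/

/-- **Stub S2' modulo Scholze's theorem and the rationality of Hecke relations** — the registered
signature of `stub_tameLevelStripping` (lead rev 3/4: level `𝔫p^r`, `r` growing with the
precision) VERBATIM, with the two tree named facts
`BigHeckeGLn.Scholze2015_gl2TowerHeckeRelations_classical` (torsion Hecke relations of the `GL₂/F`
tower are classical modulo nilpotence of UNIFORM exponent) and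
`ResGLnCohomology.heckeRelations_definedOverInt` (integral `ℚ̄_p`-relations of a parallel-weight
family are `𝒪_{ℚ̄_p}`-combinations of integer relations) as the only hypotheses.  Given `s`: take
`N` from the first fact, the finite index set `J` of `FactorsThroughFiniteLevelModP 𝒰 x (N·s)`, then
`e` and the parallel family for `J`; an integral relation `P` on the family is `Σ c_i • Q_i`
(second fact); `t_i := Q_i(heckeT) ∈ 𝕋(𝒰)` has `N`-th power vanishing in the factors indexed by
`J` (first fact, `TameLevel.coe_heckeT`), so `‖x t_i‖^N = ‖x(t_i^N)‖ ≤ p^{-Ns}`, `‖x t_i‖ ≤ p^{-s}`,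
and `‖P(x)‖ ≤ max ‖c_i‖‖x t_i‖ ≤ p^{-s}` (ultrametric). [folklore] -/
theorem stub_tameLevelStripping_of_scholze2015
    (hA : BigHeckeGLn.Scholze2015_gl2TowerHeckeRelations_classical)
    (hB : ResGLnCohomology.heckeRelations_definedOverInt) :
    ∀ (F : Type) [Field F] [NumberField F], NumberField.IsTotallyReal F → ∀ (p : ℕ) [Fact p.Prime], 5 ≤ p → ¬ ((p : ℤ) ∣ NumberField.discr F) → ∀ (𝒰 : Literature.NumberTheory.Automorphic.BigHeckeGLn.TameLevel 2 F p) (x : Literature.NumberTheory.Automorphic.CompletedCohomologyHeckeAlgebraGLn 𝒰 →+* PadicAlgCl p), (∀ t, ‖x t‖ ≤ 1) → (∀ s : ℕ, FactorsThroughFiniteLevelModP 𝒰 x s) → ∃ 𝔫 : Ideal (NumberField.RingOfIntegers F), 𝔫 ≠ 0 ∧ ∀ s : ℕ, ∃ (r m : ℕ) (lams : Fin m → (F →+* PadicAlgCl p) → Fin 2 → ℤ) (qs : Fin m → ℕ), FactorsThroughClassicalModP 𝒰 x (𝔫 * (Ideal.span {((p : ℕ) : NumberField.RingOfIntegers F)})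 ^ r) lams qs s := by
  intro F _ _ hF p _ hp hdisc 𝒰 x hint hfin
  obtain ⟨𝔫, h𝔫, N, hN, hJ⟩ := hA F hF p hp hdisc 𝒰
  refine ⟨𝔫, h𝔫, fun s => ?_⟩
  -- the finite level through which `x mod p^{N s}` factors, then the classical family for it
  obtain ⟨J, hJx⟩ := hfin (N * s)
  obtain ⟨e, m, lams, qs, hpar, hnil⟩ := hJ J
  refine ⟨e, m, lams, qs, ?_⟩
  intro r ix hix P hP hrel
  -- the level `𝔫 p^e` is non-zero
  have hp0 : (Ideal.span {((p : ℕ) : 𝓞 F)} : Ideal (𝓞 F)) ≠ 0 := by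
    rw [Ne, Ideal.zero_eq_bot, Ideal.span_singleton_eq_bot]
    exact_mod_cast (Fact.out : p.Prime).ne_zero
  have hlev : 𝔫 * Ideal.span {((p : ℕ) : 𝓞 F)} ^ e ≠ 0 := mul_ne_zero h𝔫 (pow_ne_zero _ hp0)
  -- rationality: the integral relation is an integral combination of INTEGER relations
  obtain ⟨m', c, Q, hc, hQrel, hPQ⟩ :=
    hB 2 F p _ hlev m lams qs hpar r ix (fun j => (hix j).2) P hP hrel
  -- each integer relation, evaluated in the tower, is an element of `𝕋(𝒰)` nilpotent at `J`,
  -- hence `p^{-s}`-small under `x`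
  have hsmall : ∀ i, ‖FreeRing.lift (fun j => x (𝒰.heckeT (ix j).1 (ix j).2)) (Q i)‖ ≤
      ((p : ℝ)⁻¹) ^ s := by
    intro i
    set t : CompletedCohomologyHeckeAlgebraGLn 𝒰 :=
      FreeRing.lift (fun j => 𝒰.heckeT (ix j).1 (ix j).2) (Q i) with ht
    have hcoe : ((t ^ N : CompletedCohomologyHeckeAlgebraGLn 𝒰) : 𝒰.bigEnd) =
        FreeRing.lift (fun j => 𝒰.heckeOperator (heckeElement 2 F (ix j).1 (ix j).2)) (Q i) ^ N := by
      have hfun : (fun j => ((𝒰.heckeT (ix j).1 (ix j).2 : CompletedCohomologyHeckeAlgebraGLn 𝒰) :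
          𝒰.bigEnd)) = fun j => 𝒰.heckeOperator (heckeElement 2 F (ix j).1 (ix j).2) :=
        funext fun j => 𝒰.coe_heckeT (hix j).1 _
      rw [Subring.coe_pow, ht, coe_freeRingLift, hfun]
    have hzero : ∀ idx ∈ J,
        ((t ^ N : CompletedCohomologyHeckeAlgebraGLn 𝒰) : 𝒰.bigEnd) idx = 0 := by
      intro idx hidx
      rw [hcoe]
      exact hnil r ix hix (Q i) (hQrel i) idx hidx
    have h1 : ‖x (t ^ N)‖ ≤ ((p : ℝ)⁻¹) ^ (N * s) := hJx _ hzero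
    rw [map_pow, norm_pow, pow_mul'] at h1
    have h2 : ‖x t‖ ≤ ((p : ℝ)⁻¹) ^ s := le_of_pow_le_pow_left₀ hN.ne' (by positivity) h1
    rwa [ht, ringHom_freeRingLift] at h2
  -- sum up ultrametrically
  rw [hPQ, map_sum]
  refine IsUltrametricDist.norm_sum_le_of_forall_le_of_nonneg (by positivity) fun i _ => ?_
  rw [map_smul, freeAlgebraLift_freeRingLift, norm_smul]
  calc ‖c i‖ * ‖FreeRing.lift (fun j => x (𝒰.heckeT (ix j).1 (ix j).2)) (Q i)‖
      ≤ 1 * ((p : ℝ)⁻¹) ^ s := mul_le_mul (hc i) (hsmall i) (norm_nonneg _) zero_le_one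
    _ = ((p : ℝ)⁻¹) ^ s := one_mul _

/-! ## 3. The registered stub (lead rev 5) -/

/-- **Stub S2' (registered signature, lead rev 5)**: torsion-to-classical stripping of the `p`-power
tower at level `𝔫p^r` (`r` growing with the precision) from Scholze's theorem for the `GL₂/F` tower
and the rationality of the Hecke relations — `stub_tameLevelStripping_of_scholze2015` with the two
named facts as the leading hypotheses (fed in the crux composition by the literature-debt stubs
`stub_scholze2015TowerRelations`, `stub_heckeRelationsOverInt`). [folklore] -/
theorem stub_tameLevelStripping : Literature.NumberTheory.Automorphic.BigHeckeGLn.Scholze2015_gl2TowerHeckeRelations_classical → Literature.NumberTheory.Automorphic.ResGLnCohomology.heckeRelations_definedOverInt → ∀ (F : Type) [Field F] [NumberField F], NumberField.IsTotallyReal F → ∀ (p : ℕ) [Fact p.Prime], 5 ≤ p → ¬ ((p : ℤ) ∣ NumberField.discr F) → ∀ (𝒰 : Literature.NumberTheory.Automorphic.BigHeckeGLn.TameLevel 2 F p) (x : Literature.NumberTheory.Automorphic.CompletedCohomologyHeckeAlgebraGLn 𝒰 →+* PadicAlgCl p), (∀ t, ‖x t‖ ≤ 1) → (∀ s : ℕ,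 FactorsThroughFiniteLevelModP 𝒰 x s) → ∃ 𝔫 : Ideal (NumberField.RingOfIntegers F), 𝔫 ≠ 0 ∧ ∀ s : ℕ, ∃ (r m : ℕ) (lams : Fin m → (F →+* PadicAlgCl p) → Fin 2 → ℤ) (qs : Fin m → ℕ), FactorsThroughClassicalModP 𝒰 x (𝔫 * (Ideal.span {((p : ℕ) : NumberField.RingOfIntegers F)}) ^ r) lams qs s :=
  stub_tameLevelStripping_of_scholze2015

end Summit.Langlands.Langlands.Cruxes.CrystallineProModularClassical.TorsionWeightExchange

end
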